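import Summits.BirchSwinnertonDyer.BirchSwinnertonDyer.Theses.ByReductionTypeAtTwo
import Summits.BirchSwinnertonDyer.BirchSwinnertonDyer.Theorems.ByReductionTypeAtTwoRankOneAtTwoBigImageOddLocalOneDoorFullC
import Summits.BirchSwinnertonDyer.BirchSwinnertonDyer.Theorems.ByReductionTypeAtTwoRankOneAtTwoBigImageOddLocalOneDoorAnalyticPrimary
import Summits.BirchSwinnertonDyer.BirchSwinnertonDyer.Theorems.ByReductionTypeAtTwoRankOneAtTwoOneDoorLawCDefs
import Literature.NumberTheory.Automorphic.ShimuraCurveRibetTakahashiOptimalProofs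
import HarnessLib

/-!
# Route ByReductionTypeAtTwo, crux `RankOneAtTwoBigImageOddLocal` (stmt-BirchSwinnertonDyer-23715), LINE v8.4 `one_door_analytic`
# (Manin-free): the crux BY NAME from FOUR primary printed facts + AN-28c + the route's rank-`0` cruxes

Width prover seat `bsd-line-fkl-p2` g7 (2026-08-28), `--supports stmt-BirchSwinnertonDyer-23715`; sequel of
`…OneDoorAnalyticPrimary.lean` (p621008: PUB 6 → 4 for v8.2) for the lead's MANIN-FREE reshape v8.4 (`…OneDoorFullC.lean` p621746,
`…OneDoorLawCDefs.lean` p621906, `…OneDoorAnalyticAssemblyC.lean` p622252).  The lead's `rankOneAtTwoBigImageOddLocal_of_oneDoorAnalyticC`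
takes `S_pub` (whose conjuncts `rank_eq_analyticRank_of_analyticRank_le_one` — GZK over `ℚ`, COMPOSITE — and `hasEntireLFunction_rat`
are used by `bsdp_two_iff_doorLawFullC_at` only for `rank E(ℚ) = 1` and the entire continuation).  Here:

* `bsdp_two_iff_doorLawFullC_at_of_rank` — the lead's c-floating per-datum iff VERBATIM (p621746) with the binder `hGZK` replaced by
  `hrQ : W.mordellWeilRank = 1` (door = `bsdp_two_iff_of_heegner_rankOne_of_rank`, p620211);
* `doorGlueAnC_of_primary` — the lead's `doorGlueAnC` over that iff, binders `hGZ`, `hKo`, `hnf` in place of `S_pub`; the Mordell–Weil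
  rank `1` is the hypothesis of `S_sliceMW` (now USED);
* `rankOneAtTwoBigImageOddLocal_of_oneDoorAnalyticC_primary4` — **the crux BY NAME from `gross_zagier`, `kolyvagin`, `exists_isNewformOf`,
  `HoffsteinLuo1997_exists_twist_L_one_ne_zero`, the conjecture `DoorIndexLawFullCAtTwo` (AN-28c, unguarded) and the route's four rank-`0`
  cruxes** — rank `1` by `mordellWeilRank_eq_one_of_analyticRank_eq_one_of_isGloballyMinimal` (p621008), entire continuation by
  `hasEntireLFunction_rat_of_exists_isNewformOf`.  No Manin input, no GZK binder.

BSD is not proved by any of this; the final theorem is conditional by design on four PRINT named facts, one conjecture and four open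
route items.
-/

set_option autoImplicit false

noncomputable section

open scoped Classical

set_option linter.dupNamespace false

namespace Summit.BirchSwinnertonDyer.BirchSwinnertonDyer.Theorems.RankOneAtTwoOneDoor

open WeierstrassCurve NumberField IsDedekindDomain Rat.HeightOneSpectrum Literature.NumberTheory.EllipticCurves
  Literature.NumberTheory.EllipticCurves.ModularForms
  Literature.NumberTheory.EllipticCurves.KrizLi2019
  Summit.BirchSwinnertonDyer.Rank1Residual.F1Sign2
  Summit.BirchSwinnertonDyer.Rank1Residual.F1Sign2.TranspositionDoor
  Summit.BirchSwinnertonDyer.Rank1Residual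
  Summit.BirchSwinnertonDyer.BirchSwinnertonDyer.Theses.ByReductionTypeAtTwo

/-- **The FULL door law, parametrisation constant floating, is an EQUIVALENCE at every non-vanishing door datum — GZK binder
replaced by `hrQ : W.mordellWeilRank = 1`** (otherwise VERBATIM the lead's `bsdp_two_iff_doorLawFullC_at`, p621746).  `W/ℚ`
globally minimal, odd `#E(ℚ)_tors`, odd `∏ c_ℓ`, analytic rank `1`; `K` imaginary quadratic with `d_K` door-admissible, Heegner
hypothesis for `N_E`, `L(E^{(d_K)},1) ≠ 0`; `Dt` ANY parametrisation datum of level `N_E` (constant `c ≠ 0` by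
`maninConstant_ne_zero_holds`; no parity assumed), `H`, `ι`, `P ∈ E(K)` mapping to the complex Heegner point; a globally minimal
model `Wd` of the twist satisfying `BSD(Wd, 2)`; published inputs Gross–Zagier / Kolyvagin at `(N_E, W, K)`, modularity, and
`rank E(ℚ) = 1` (`hrQ`); the Tamagawa receptacle `DoorTwistTamagawaAtTwo`.  THEN, with `s_d := ord₂ #Ш(Wd)[2^∞]`,
`BSDp W 2 ↔ ∃ m, (P ≡ 2^m Q, Q not twice, mod torsion) ∧ 2m + [Δ_W < 0] = ord₂ #Ш(W)[2^∞] + s_d + t + 2s + 2·v₂(c)`.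
(The constant enters the door's rational as `c²` in the denominator; a datum with `φ_D = n·φ₁` has `c_D = n c₁` and Heegner
point `n·P₁`, so `2m − 2v₂(c)` is the datum-free quantity.)
[cite: GrossZagier1986, Thm. I.6.3 and V.§2] [cite: Pal2012, Prop. 2.5 and Cor. 2.6] -/
theorem bsdp_two_iff_doorLawFullC_at_of_rank
    (hmod : hasEntireLFunction_rat) (hTam : DoorTwistTamagawaAtTwo)
    (W : WeierstrassCurve ℚ) [W.IsElliptic] [W.IsGloballyMinimal] [NeZero (W.conductorNorm ℤ)]
    (hT : Odd W.torsionOrder) (hc : Odd W.tamagawaProduct) (hr : W.analyticRank = 1) (hrQ : W.mordellWeilRank = 1)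
    (K : Type) [Field K] [NumberField K] (hK : IsImaginaryQuadratic K)
    (hGZ : gross_zagier (W.conductorNorm ℤ) W K) (hKo : kolyvagin (W.conductorNorm ℤ) W K)
    (hadm : DoorAdmissible W (NumberField.discr K))
    (hHN : SatisfiesHeegnerHypothesis (W.conductorNorm ℤ) K)
    (hLt : (W.quadraticTwist (NumberField.discr K : ℚ)).entireLFunction 1 ≠ 0)
    (Dt : ModularParametrizationData W (W.conductorNorm ℤ))
    (H : HeegnerDatum (W.conductorNorm ℤ) (NumberField.discr K)) (ι : K →+* ℂ)
    (P : (W.baseChange K).toAffine.Point)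
    (hP : WeierstrassCurve.Affine.Point.map ι.toRatAlgHom P = heegnerPointComplex Dt H)
    (Wd : WeierstrassCurve ℚ) [Wd.IsElliptic] [Wd.IsGloballyMinimal] (Cd : VariableChange ℚ)
    (hWd : Cd • W.quadraticTwist (NumberField.discr K : ℚ) = Wd) (hBd : BSDp Wd 2) :
    Finite (AddCommGroup.primaryComponent W.sha 2) ∧ Finite (AddCommGroup.primaryComponent Wd.sha 2) ∧
      (BSDp W 2 ↔
        ∃ m : ℕ, HasTwoDivisibilityUpToTorsion W K P m ∧
          2 * m + (if W.Δ < 0 then 1 else 0) =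
            padicValNat 2 (Nat.card (AddCommGroup.primaryComponent W.sha 2)) +
              padicValNat 2 (Nat.card (AddCommGroup.primaryComponent Wd.sha 2)) +
              transpCount W (NumberField.discr K) + 2 * identCount W (NumberField.discr K) +
              2 * padicValInt 2 Dt.c) := by
  haveI : Fact (Nat.Prime 2) := ⟨Nat.prime_two⟩
  have hT2 : NoRationalTwoTorsion W := noRationalTwoTorsion_of_odd_torsionOrder W hT
  have h2 : Module.finrank ℚ K = 2 := hK.1
  haveI : IsTotallyComplex K := hK.2
  -- the twist model: `L(Wd,1) ≠ 0`, analytic rank `0`, `BSD(Wd,2)` unpacked in rank `0`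
  have hD0 : (NumberField.discr K : ℚ) ≠ 0 := by exact_mod_cast NumberField.discr_ne_zero K
  haveI hEt : (W.quadraticTwist (NumberField.discr K : ℚ)).IsElliptic := W.isElliptic_quadraticTwist hD0
  have hLeq : Wd.entireLFunction = (W.quadraticTwist (NumberField.discr K : ℚ)).entireLFunction := by
    rw [← hWd, entireLFunction_smul]
  have hLd : Wd.entireLFunction 1 ≠ 0 := by rw [hLeq]; exact hLt
  have hrd : Wd.analyticRank = 0 := (Wd.analyticRank_eq_zero_iff_holds (hmod Wd)).2 hLd
  obtain ⟨hrankd, hfind, q', hq', hv'⟩ := hBd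
  haveI := hfind
  have hrkd : Wd.mordellWeilRank = 0 := by rw [hrankd, hrd]
  -- `Wd(ℚ)[2] = 0` (twist invariance of `E(ℚ)[2] = 0`), hence `#Wd(ℚ)_tors` odd
  have hW2 : ∀ T : W.toAffine.Point, 2 • T = 0 → T = 0 := EggDoubling.eq_zero_of_two_smul_eq_zero W hT2
  have hWd2 : ∀ T : Wd.toAffine.Point, 2 • T = 0 → T = 0 := by
    have hbotW : AddSubgroup.torsionBy W.toAffine.Point (2 : ℤ) = ⊥ :=
      Summit.BirchSwinnertonDyer.Uniform.U2.torsionBy_two_eq_bot_iff.mpr hW2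
    have hbotWd := Summit.BirchSwinnertonDyer.Uniform.U2.torsionBy_two_eq_bot_of_twist W hD0 Wd ⟨Cd⁻¹, by
      rw [← hWd, inv_smul_smul]⟩ hbotW
    exact Summit.BirchSwinnertonDyer.Uniform.U2.torsionBy_two_eq_bot_iff.mp hbotWd
  have hTdodd : Odd Wd.torsionOrder := by
    -- Cauchy in `Wd(ℚ)_tors` (as in `…OneDoorValue.odd_torsionOrder_of_two_smul_eq_zero`, which imports the route file)
    rw [← Nat.not_even_iff_odd, even_iff_two_dvd]
    intro hdvd
    obtain ⟨T, hT'⟩ := exists_addOrderOf_eq_of_dvd_torsionOrder Wd 2 hdvd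
    have h2T : 2 • T = 0 := by
      have h := addOrderOf_nsmul_eq_zero T
      rwa [hT'] at h
    have hT0 : T = 0 := hWd2 T h2T
    rw [hT0, addOrderOf_zero] at hT'
    exact absurd hT' (by norm_num)
  have hvTd : padicValNat 2 Wd.torsionOrder = 0 :=
    padicValNat.eq_zero_of_not_dvd (fun h => (Nat.not_even_iff_odd.mpr hTdodd) (even_iff_two_dvd.mpr h))
  -- the value `q_d = L(Wd,1)/Ω(Wd)` and its valuation `s_d + ord₂ ∏c_ℓ(Wd) - 2 ord₂ #T`
  have hlead : Wd.leadingLCoeff = Wd.entireLFunction 1 :=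
    WeierstrassCurve.leadingLCoeff_eq_of_analyticRank_eq_zero Wd hrd
  have hreg : Wd.regulator = 1 := Wd.regulator_eq_one_of_rank_zero hrkd
  have hΩdpos : 0 < Wd.realPeriodRat := Wd.realPeriodRat_pos_holds
  have hΩdC : (Wd.realPeriodRat : ℂ) ≠ 0 := by exact_mod_cast hΩdpos.ne'
  have hTd0 : 0 < Wd.torsionOrder := Wd.torsionOrder_pos_holds
  have hcd0 : 0 < Wd.tamagawaProduct := Wd.tamagawaProduct_pos_holds
  set qd : ℚ := q' * Wd.tamagawaProduct / (Wd.torsionOrder : ℚ) ^ 2 with hqd_def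
  have hsha := hq'
  rw [shaAn_def, hlead, hreg, Complex.ofReal_one, mul_one] at hsha
  have hqd : Wd.entireLFunction 1 / (Wd.realPeriodRat : ℂ) = (qd : ℂ) := by
    have hTC : (Wd.torsionOrder : ℂ) ≠ 0 := by exact_mod_cast hTd0.ne'
    have hcC : (Wd.tamagawaProduct : ℂ) ≠ 0 := by exact_mod_cast hcd0.ne'
    have h1 : Wd.entireLFunction 1 * (Wd.torsionOrder : ℂ) ^ 2 =
        (q' : ℂ) * ((Wd.realPeriodRat : ℂ) * (Wd.tamagawaProduct : ℂ)) := by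
      rw [← hsha]; field_simp
    rw [hqd_def]
    push_cast
    field_simp
    linear_combination h1
  have hq'0 : q' ≠ 0 := by
    intro h0
    apply hLd
    have := hqd
    rw [hqd_def, h0, zero_mul, zero_div, Rat.cast_zero, div_eq_zero_iff] at this
    rcases this with h | h
    · exact h
    · exact absurd h hΩdC
  have hTq : (Wd.torsionOrder : ℚ) ≠ 0 := by exact_mod_cast hTd0.ne'
  have hcq : (Wd.tamagawaProduct : ℚ) ≠ 0 := by exact_mod_cast hcd0.ne'
  have hqd0 : qd ≠ 0 := by
    rw [hqd_def]; exact div_ne_zero (mul_ne_zero hq'0 hcq) (pow_ne_zero _ hTq)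
  have hvqd : padicValRat 2 qd =
      (padicValNat 2 (Nat.card (AddCommGroup.primaryComponent Wd.sha 2)) : ℤ) +
        padicValNat 2 W.tamagawaProduct + transpCount W (NumberField.discr K) + 2 * identCount W (NumberField.discr K) := by
    rw [hqd_def, padicValRat.div (mul_ne_zero hq'0 hcq) (pow_ne_zero _ hTq), padicValRat.mul hq'0 hcq,
      padicValRat.pow, padicValRat.of_nat, padicValRat.of_nat, hv', hvTd, hTam W (NumberField.discr K) hadm Wd Cd hWd]
    push_cast
    ring
  have hc0 : Dt.c ≠ 0 := Dt.maninConstant_ne_zero_holds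
  -- the door
  obtain ⟨k, hk12, hkiff, hdoor⟩ :=
    bsdp_two_iff_of_heegner_rankOne_of_rank W (W.conductorNorm ℤ) K Dt H ι P hGZ hKo hmod hK hHN hP hc0 hr hrQ hLt Wd Cd
      hWd qd hqd
  ------------------------------------------------------------------ rank `E(K) = 1`, `Ш(E)` finite
  haveI hEK : (W.baseChange K).IsElliptic := isElliptic_baseChange' W K
  have hL0 : W.entireLFunction 1 = 0 := entireLFunction_one_eq_zero_of_analyticRank_eq_one hr
  obtain ⟨-, hderiv⟩ := leadingLCoeff_eq_deriv_of_analyticRank_eq_one hr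
  have hprod := lDerivEK_eq_deriv_mul W K hmod hL0
  have hLK : LDerivEK W K ≠ 0 := by rw [hprod]; exact mul_ne_zero hderiv hLt
  have hPH : IsHeegnerPoint (W.conductorNorm ℤ) W K P := ⟨Dt, H, ι, hP⟩
  have hPinf : ¬ IsOfFinAddOrder P :=
    (lDerivEK_ne_zero_iff_not_isOfFinAddOrder W (W.conductorNorm ℤ) K hGZ hK hHN hPH).mp hLK
  obtain ⟨hrkK, hShaK⟩ := hKo hK hHN hPH hPinf
  have hShaW : W.ShaFinite := Literature.NumberTheory.EllipticCurves.shaFinite_of_baseChange W K hShaK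
  haveI hfinW : Finite W.sha := hShaW
  have hfin2 : Finite (AddCommGroup.primaryComponent W.sha 2) := inferInstance
  have hrk : W.mordellWeilRank = 1 := hrQ
  ------------------------------------------------------------------ `#E(K)_tors` odd, `k = 1`
  have htKodd : Odd (W.baseChange K).torsionOrder := odd_torsionOrder_baseChange_of_noRationalTwoTorsion W hT2 K h2
  have hk1 : k = 1 := by
    rcases hk12 with h | h
    · exact h
    · exact absurd (hkiff.mp h) (P2.not_forall_halvable_of_odd_torsionOrder W K h2 hrkK hrk htKodd)
  have hvtK : padicValNat 2 (W.baseChange K).torsionOrder = 0 :=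
    padicValNat.eq_zero_of_not_dvd (fun h => (Nat.not_even_iff_odd.mpr htKodd) (even_iff_two_dvd.mpr h))
  ------------------------------------------------------------------ the generator of `E(K)/tors`
  obtain ⟨gK, hgK, hgenK, huniqK, -⟩ :=
    exists_generator_regulator_eq_of_mordellWeilRank_eq_one (W.baseChange K) hrkK
  ------------------------------------------------------------------ `w_K = 2`, `|u| = 1`, oddness
  have hw2 : Units.torsionOrder K = 2 :=
    Literature.NumberTheory.QuadraticFields.Quadratic.torsionOrder_eq_two_of_discr_lt_neg_four h2
      (discr_lt_neg_four_of_doorAdmissible hadm)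
  have hu1 : |(Cd.u : ℚ)| = 1 := by
    rcases W.u_eq_one_or_eq_neg_one_of_smul_quadraticTwist_of_squarefree (emod_four_of_doorAdmissible hadm)
        hadm.2.1 (good_or_mult_at_dvd_of_doorAdmissible W hadm) Wd Cd hWd with h | h <;> rw [h] <;> simp
  have hvcWn : padicValNat 2 W.tamagawaProduct = 0 :=
    padicValNat.eq_zero_of_not_dvd (fun h => (Nat.not_even_iff_odd.mpr hc) (even_iff_two_dvd.mpr h))
  ------------------------------------------------------------------ the valuation, for ANY exponent `m` of `P`
  have hΔ0 : W.Δ ≠ 0 := W.isUnit_Δ.ne_zero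
  have htW' : (W.torsionOrder : ℚ) ≠ 0 := by exact_mod_cast (W.torsionOrder_pos_holds).ne'
  have htK' : ((W.baseChange K).torsionOrder : ℚ) ≠ 0 := by
    exact_mod_cast ((W.baseChange K).torsionOrder_pos_holds).ne'
  have hcW' : (W.tamagawaProduct : ℚ) ≠ 0 := by exact_mod_cast (W.tamagawaProduct_pos_holds).ne'
  have hcM : (Dt.c : ℚ) ≠ 0 := by exact_mod_cast hc0
  have hw' : (Units.torsionOrder K : ℚ) ≠ 0 := by rw [hw2]; norm_num
  have hua : |(Cd.u : ℚ)| ≠ 0 := abs_ne_zero.mpr Cd.u.ne_zero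
  have hk' : ((k : ℕ) : ℚ) ≠ 0 := by rw [hk1]; norm_num
  have hn12 : (W.baseChange ℝ).numRealComponents = 1 ∨ (W.baseChange ℝ).numRealComponents = 2 :=
    numRealComponents_eq_one_or W
  have hn' : ((W.baseChange ℝ).numRealComponents : ℚ) ≠ 0 := by
    rcases hn12 with h | h <;> rw [h] <;> norm_num
  have h8 : padicValRat 2 (8 : ℚ) = 3 := by
    rw [show (8 : ℚ) = ((2 : ℕ) : ℚ) ^ 3 by norm_num, padicValRat.pow, padicValRat.self one_lt_two]; norm_num
  have hvtW : padicValRat 2 (W.torsionOrder : ℚ) = 0 := by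
    rw [padicValRat.of_nat, padicValNat.eq_zero_of_not_dvd
      (fun h => (Nat.not_even_iff_odd.mpr hT) (even_iff_two_dvd.mpr h))]; rfl
  have hvtKq : padicValRat 2 ((W.baseChange K).torsionOrder : ℚ) = 0 := by
    rw [padicValRat.of_nat, hvtK]; rfl
  have hvcW : padicValRat 2 (W.tamagawaProduct : ℚ) = 0 := by
    rw [padicValRat.of_nat, hvcWn]; rfl
  have hvc : padicValRat 2 (Dt.c : ℚ) = (padicValInt 2 Dt.c : ℤ) := padicValRat.of_int
  have hvw : padicValRat 2 (Units.torsionOrder K : ℚ) = 1 := by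
    rw [hw2]; exact padicValRat.self one_lt_two
  have hvu : padicValRat 2 |(Cd.u : ℚ)| = 0 := by rw [hu1]; exact padicValRat.one
  have hvk : padicValRat 2 ((k : ℕ) : ℚ) = 0 := by
    rw [hk1, Nat.cast_one]; exact padicValRat.one
  have hvqd' : padicValRat 2 qd =
      (padicValNat 2 (Nat.card (AddCommGroup.primaryComponent Wd.sha 2)) : ℤ) +
        ((transpCount W (NumberField.discr K) : ℤ) + 2 * (identCount W (NumberField.discr K) : ℤ)) := by
    rw [hvqd, hvcWn]; push_cast; ring
  have hD1 : ((W.baseChange ℝ).numRealComponents : ℚ) * ((k : ℕ) : ℚ) ^ 2 ≠ 0 :=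
    mul_ne_zero hn' (pow_ne_zero _ hk')
  have hD2 : ((W.baseChange ℝ).numRealComponents : ℚ) * ((k : ℕ) : ℚ) ^ 2 *
      ((W.baseChange K).torsionOrder : ℚ) ^ 2 ≠ 0 := mul_ne_zero hD1 (pow_ne_zero _ htK')
  have hD3 : ((W.baseChange ℝ).numRealComponents : ℚ) * ((k : ℕ) : ℚ) ^ 2 *
      ((W.baseChange K).torsionOrder : ℚ) ^ 2 * (Dt.c : ℚ) ^ 2 ≠ 0 := mul_ne_zero hD2 (pow_ne_zero _ hcM)
  have hD4 : ((W.baseChange ℝ).numRealComponents : ℚ) * ((k : ℕ) : ℚ) ^ 2 *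
      ((W.baseChange K).torsionOrder : ℚ) ^ 2 * (Dt.c : ℚ) ^ 2 * (Units.torsionOrder K : ℚ) ^ 2 ≠ 0 :=
    mul_ne_zero hD3 (pow_ne_zero _ hw')
  have hD5 : ((W.baseChange ℝ).numRealComponents : ℚ) * ((k : ℕ) : ℚ) ^ 2 *
      ((W.baseChange K).torsionOrder : ℚ) ^ 2 * (Dt.c : ℚ) ^ 2 * (Units.torsionOrder K : ℚ) ^ 2 * qd ≠ 0 :=
    mul_ne_zero hD4 hqd0
  have hD6 : ((W.baseChange ℝ).numRealComponents : ℚ) * ((k : ℕ) : ℚ) ^ 2 *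
      ((W.baseChange K).torsionOrder : ℚ) ^ 2 * (Dt.c : ℚ) ^ 2 * (Units.torsionOrder K : ℚ) ^ 2 * qd *
      |(Cd.u : ℚ)| ≠ 0 := mul_ne_zero hD5 hua
  have hD7 : ((W.baseChange ℝ).numRealComponents : ℚ) * ((k : ℕ) : ℚ) ^ 2 *
      ((W.baseChange K).torsionOrder : ℚ) ^ 2 * (Dt.c : ℚ) ^ 2 * (Units.torsionOrder K : ℚ) ^ 2 * qd *
      |(Cd.u : ℚ)| * (W.tamagawaProduct : ℚ) ≠ 0 := mul_ne_zero hD6 hcW'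
  have hden : padicValRat 2 (((W.baseChange ℝ).numRealComponents : ℚ) * ((k : ℕ) : ℚ) ^ 2 *
      ((W.baseChange K).torsionOrder : ℚ) ^ 2 * (Dt.c : ℚ) ^ 2 * (Units.torsionOrder K : ℚ) ^ 2 * qd *
      |(Cd.u : ℚ)| * (W.tamagawaProduct : ℚ)) =
      padicValRat 2 ((W.baseChange ℝ).numRealComponents : ℚ) + 2 + 2 * (padicValInt 2 Dt.c : ℤ) +
        ((padicValNat 2 (Nat.card (AddCommGroup.primaryComponent Wd.sha 2)) : ℤ) +
          ((transpCount W (NumberField.discr K) : ℤ) + 2 * (identCount W (NumberField.discr K) : ℤ))) := by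
    rw [padicValRat.mul hD6 hcW', padicValRat.mul hD5 hua, padicValRat.mul hD4 hqd0,
      padicValRat.mul hD3 (pow_ne_zero _ hw'), padicValRat.mul hD2 (pow_ne_zero _ hcM),
      padicValRat.mul hD1 (pow_ne_zero _ htK'), padicValRat.mul hn' (pow_ne_zero _ hk'),
      padicValRat.pow, padicValRat.pow, padicValRat.pow, padicValRat.pow,
      hvk, hvtKq, hvc, hvw, hvqd', hvu, hvcW]
    ring
  have hprim : padicValNat 2 (Nat.card (AddCommGroup.primaryComponent W.sha 2)) =
      padicValNat 2 (Nat.card W.sha) := padicValNat_card_addPrimaryComponent 2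
  -- `[Δ<0]` and `v₂ n` add up to `1`
  have hsign : padicValRat 2 ((W.baseChange ℝ).numRealComponents : ℚ) + (if W.Δ < 0 then 1 else 0 : ℕ) = 1 := by
    rcases lt_or_gt_of_ne hΔ0 with hneg | hpos
    · rw [if_pos hneg, P2.numRealComponents_eq_one_of_Δ_neg hneg, Nat.cast_one, padicValRat.one]; norm_num
    · rw [if_neg (not_lt.mpr hpos.le), P2.numRealComponents_eq_two_of_Δ_pos hpos, padicValRat.self one_lt_two]
      norm_num
  -- the valuation of the door's rational for a point with exponent `m`
  have hval : ∀ {m : ℕ} {Q : (W.baseChange K).toAffine.Point},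
      P - (2 ^ m) • Q ∈ AddCommGroup.torsion (W.baseChange K).toAffine.Point →
      (¬ ∃ Q' : (W.baseChange K).toAffine.Point,
          Q - 2 • Q' ∈ AddCommGroup.torsion (W.baseChange K).toAffine.Point) →
      padicValRat 2
          (8 * ((AddSubgroup.zmultiples P).index : ℚ) ^ 2 * (W.torsionOrder : ℚ) ^ 2 /
            (((W.baseChange ℝ).numRealComponents : ℚ) * (k : ℚ) ^ 2 *
              ((W.baseChange K).torsionOrder : ℚ) ^ 2 * (Dt.c : ℚ) ^ 2 *
              (Units.torsionOrder K : ℚ) ^ 2 * qd * |(Cd.u : ℚ)| * (W.tamagawaProduct : ℚ))) =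
        3 + 2 * (m : ℤ) - (padicValRat 2 ((W.baseChange ℝ).numRealComponents : ℚ) + 2 + 2 * (padicValInt 2 Dt.c : ℤ) +
          ((padicValNat 2 (Nat.card (AddCommGroup.primaryComponent Wd.sha 2)) : ℤ) +
            ((transpCount W (NumberField.discr K) : ℤ) + 2 * (identCount W (NumberField.discr K) : ℤ)))) := by
    intro m Q hPQ hQ
    obtain ⟨hI0, hvIdx⟩ := padicValNat_index_of_twoDivisibility (W.baseChange K) hgK hgenK hPQ hQ
    have hI' : ((AddSubgroup.zmultiples P).index : ℚ) ≠ 0 := by exact_mod_cast hI0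
    have hvI : padicValRat 2 ((AddSubgroup.zmultiples P).index : ℚ) = (m : ℤ) := by
      rw [padicValRat.of_nat, hvIdx, hvtK]; push_cast; ring
    have hA1 : (8 : ℚ) * ((AddSubgroup.zmultiples P).index : ℚ) ^ 2 ≠ 0 :=
      mul_ne_zero (by norm_num) (pow_ne_zero _ hI')
    have hA2 : (8 : ℚ) * ((AddSubgroup.zmultiples P).index : ℚ) ^ 2 * (W.torsionOrder : ℚ) ^ 2 ≠ 0 :=
      mul_ne_zero hA1 (pow_ne_zero _ htW')
    have hnum : padicValRat 2 ((8 : ℚ) * ((AddSubgroup.zmultiples P).index : ℚ) ^ 2 * (W.torsionOrder : ℚ) ^ 2) =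
        3 + 2 * (m : ℤ) := by
      rw [padicValRat.mul hA1 (pow_ne_zero _ htW'), padicValRat.mul (by norm_num) (pow_ne_zero _ hI'),
        padicValRat.pow, padicValRat.pow, h8, hvI, hvtW]
      ring
    rw [padicValRat.div hA2 hD7, hnum, hden]
  refine ⟨hfin2, hfind, ?_⟩
  constructor
  · ---------------------------------------------------------------- BSD₂ ⇒ the law at the datum's own exponent
    intro hB
    obtain ⟨m, Q, hPQ, hQ⟩ := exists_twoDivisibility_of_rankOne (W.baseChange K) hgenK huniqK hPinf
    refine ⟨m, ⟨Q, hPQ, hQ⟩, ?_⟩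
    have hv := (hdoor.mp hB)
    rw [hval hPQ hQ, ← hprim] at hv
    have hv' := hsign
    zify
    push_cast at hv hv' ⊢
    linarith
  · ---------------------------------------------------------------- the law ⇒ BSD₂
    rintro ⟨m, ⟨Q, hPQ, hQ⟩, hlaw⟩
    apply hdoor.mpr
    have hQ' : ¬ ∃ Q' : (W.baseChange K).toAffine.Point,
        Q - 2 • Q' ∈ AddCommGroup.torsion (W.baseChange K).toAffine.Point := hQ
    rw [hval hPQ hQ', ← hprim]
    have hlawZ : (2 * m : ℤ) + ((if W.Δ < 0 then 1 else 0 : ℕ) : ℤ) =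
        (padicValNat 2 (Nat.card (AddCommGroup.primaryComponent W.sha 2)) : ℤ) +
          padicValNat 2 (Nat.card (AddCommGroup.primaryComponent Wd.sha 2)) +
          transpCount W (NumberField.discr K) + 2 * identCount W (NumberField.discr K) +
          2 * (padicValInt 2 Dt.c : ℤ) := by
      exact_mod_cast hlaw
    have hv' := hsign
    linarith


/-! ### The Manin-free glue and assembly over the re-proved iff -/

/-- **The Manin-free glue of LINE v8.4 with the GZK conjunct of `S_pub` DROPPED** (the lead's `doorGlueAnC`, p622252, verbatim over
`bsdp_two_iff_doorLawFullC_at_of_rank`): Gross–Zagier (`hGZ`), Kolyvagin (`hKo`), modularity as a newform (`hnf`: existence of a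
datum of ANY constant, the `K`-rationality theorem, the entire continuation), the floating-constant door law AN-28c, rank-`0` `BSD₂`
for non-CM curves, and the Hoffstein–Luo door supply give `BSD₂` on the slice; the Mordell–Weil rank `1` is the hypothesis of
`S_sliceMW` (used). [cite: GrossZagier1986, Thm. I.6.3 and V.§2] -/
theorem doorGlueAnC_of_primary
    (hGZ : ∀ (N : ℕ) [NeZero N] (W : WeierstrassCurve ℚ) (K : Type) [Field K] [NumberField K], gross_zagier N W K)
    (hKo : ∀ (N : ℕ) [NeZero N] (W : WeierstrassCurve ℚ) (K : Type) [Field K] [NumberField K], kolyvagin N W K)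
    (hnf : exists_isNewformOf) (hIdx : DoorIndexLawFullCAtTwo) (hZ : S_rankZeroTwin)
    (hSup : DoorSupplyAnalyticAtTwo) : S_sliceMW := by
  intro W _ _ hCM hsurj hT hc hr hrk
  have hmod : hasEntireLFunction_rat := hasEntireLFunction_rat_of_exists_isNewformOf hnf
  haveI : Fact (Nat.Prime 2) := ⟨Nat.prime_two⟩
  haveI hN : NeZero (W.conductorNorm ℤ) := ⟨(W.conductorNorm_pos_holds).ne'⟩
  -- the door field (Waldspurger–Hoffstein–Luo): admissible, `L(E^{(d_K)},1) ≠ 0`, Heegner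
  obtain ⟨K, _iF, _iN, hK, hadm, hLt, -, hHN⟩ := hSup W hr
  -- ANY parametrisation datum at level `N_E` (modularity; its constant is not constrained), `H`, `ι`, the `K`-rational point
  obtain ⟨Dt⟩ := (nonempty_modularParametrizationData_iff_exists_isNewformOf_unconditional.mpr hnf) W
  obtain ⟨H, -⟩ :=
    nonempty_heegnerDatum_holds (W.conductorNorm ℤ) K hK (exists_dvd_sq_sub_discr_holds (W.conductorNorm ℤ) K hK hHN).choose_spec
  obtain ⟨ι⟩ : Nonempty (K →+* ℂ) := inferInstance
  obtain ⟨P, hP⟩ := heegnerPointComplex_mem_range_map_holds (W.conductorNorm ℤ) W K hK hHN Dt H ι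
  -- a globally minimal model of the twist; it is non-CM of analytic rank `0`, so `BSD(Wd, 2)` by `S_rankZeroTwin`
  have hD0 : (NumberField.discr K : ℚ) ≠ 0 := by exact_mod_cast NumberField.discr_ne_zero K
  haveI hEt : (W.quadraticTwist (NumberField.discr K : ℚ)).IsElliptic := W.isElliptic_quadraticTwist hD0
  obtain ⟨Cd, hCd⟩ := hasGlobalMinimalModel_rat_holds (W.quadraticTwist (NumberField.discr K : ℚ))
  haveI : (Cd • W.quadraticTwist (NumberField.discr K : ℚ)).IsGloballyMinimal := hCd
  set Wd := Cd • W.quadraticTwist (NumberField.discr K : ℚ) with hWd_def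
  have hWd : Cd • W.quadraticTwist (NumberField.discr K : ℚ) = Wd := rfl
  have hCMd : ¬ Wd.HasCM := RamifiedPairUpperBound.not_hasCM_of_smul_quadraticTwist_eq hD0 hWd hCM
  have hLeq : Wd.entireLFunction = (W.quadraticTwist (NumberField.discr K : ℚ)).entireLFunction := by
    rw [← hWd, entireLFunction_smul]
  have hrd : Wd.analyticRank = 0 :=
    (Wd.analyticRank_eq_zero_iff_holds (hmod Wd)).2 (by rw [hLeq]; exact hLt)
  have hBd : BSDp Wd 2 := hZ Wd hCMd hrd
  -- the per-datum equivalence, read from right to left at the law's identity for THIS datum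
  obtain ⟨-, -, hiff⟩ :=
    bsdp_two_iff_doorLawFullC_at_of_rank hmod doorTwistTamagawaAtTwo W hT hc hr hrk K hK (hGZ _ W K) (hKo _ W K) hadm hHN hLt
      Dt H ι P hP Wd Cd hWd hBd
  exact hiff.mpr (hIdx W hCM hsurj hT hc hr K hK hadm hLt Dt H ι P hP Wd Cd hWd)

/-- **The crux `RankOneAtTwoBigImageOddLocal` BY NAME from LINE v8.4's inputs with the PRINT part reduced to FOUR PRIMARY named facts**:
Gross–Zagier (`gross_zagier`), Kolyvagin (`kolyvagin`), modularity as a newform (`exists_isNewformOf`), Hoffstein–Luo 1997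
(`HoffsteinLuo1997_exists_twist_L_one_ne_zero`); plus the lens' Manin-free conjecture `DoorIndexLawFullCAtTwo` (AN-28c, load-bearing,
unguarded) and the route's four rank-`0` cruxes at `2` BY NAME.  No Manin input; `rank E(ℚ) = 1` from the four facts
(`mordellWeilRank_eq_one_of_analyticRank_eq_one_of_isGloballyMinimal`).  BSD is not proved by this: conditional by design. -/
theorem rankOneAtTwoBigImageOddLocal_of_oneDoorAnalyticC_primary4
    (hGZ : ∀ (N : ℕ) [NeZero N] (W : WeierstrassCurve ℚ) (K : Type) [Field K] [NumberField K], gross_zagier N W K)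
    (hKo : ∀ (N : ℕ) [NeZero N] (W : WeierstrassCurve ℚ) (K : Type) [Field K] [NumberField K], kolyvagin N W K)
    (hnf : exists_isNewformOf) (hHL : HoffsteinLuo1997_exists_twist_L_one_ne_zero)
    (hIdx : DoorIndexLawFullCAtTwo)
    (hZ4 : GoodOrdinaryRankZeroAtTwo ∧ MultiplicativeRankZeroAtTwo ∧ SupersingularRankZeroAtTwo ∧ AdditiveRankZeroAtTwo) :
    RankOneAtTwoBigImageOddLocal := by
  intro W _ _ hCM hsurj hT hc hr
  have hZ : S_rankZeroTwin := fun V _ _ hVCM hV0 => bsdp_two_of_rankZero_cruxes hZ4 V hVCM hV0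
  have hrk : W.mordellWeilRank = 1 :=
    (mordellWeilRank_eq_one_of_analyticRank_eq_one_of_isGloballyMinimal hGZ hKo hnf hHL W hr).1
  exact doorGlueAnC_of_primary hGZ hKo hnf hIdx hZ (doorSupplyAnalyticAtTwo_of_hoffsteinLuo hnf hHL) W hCM hsurj hT hc hr hrk

/-- The same with `S_rankZeroTwin` in place of the four route items. BSD is not proved by this: conditional by design. -/
theorem rankOneAtTwoBigImageOddLocal_of_oneDoorAnalyticC_primary4'
    (hGZ : ∀ (N : ℕ) [NeZero N] (W : WeierstrassCurve ℚ) (K : Type) [Field K] [NumberField K], gross_zagier N W K)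
    (hKo : ∀ (N : ℕ) [NeZero N] (W : WeierstrassCurve ℚ) (K : Type) [Field K] [NumberField K], kolyvagin N W K)
    (hnf : exists_isNewformOf) (hHL : HoffsteinLuo1997_exists_twist_L_one_ne_zero)
    (hIdx : DoorIndexLawFullCAtTwo) (hZ : S_rankZeroTwin) : RankOneAtTwoBigImageOddLocal := by
  intro W _ _ hCM hsurj hT hc hr
  have hrk : W.mordellWeilRank = 1 :=
    (mordellWeilRank_eq_one_of_analyticRank_eq_one_of_isGloballyMinimal hGZ hKo hnf hHL W hr).1
  exact doorGlueAnC_of_primary hGZ hKo hnf hIdx hZ (doorSupplyAnalyticAtTwo_of_hoffsteinLuo hnf hHL) W hCM hsurj hT hc hr hrk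

end Summit.BirchSwinnertonDyer.BirchSwinnertonDyer.Theorems.RankOneAtTwoOneDoor

end
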